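import Summits.Ventures.DiscreteObjects.Hadamard.PrimeOrder17to47

/-!
# Hadamard 668 census, family F12 — order 29: the kernel pins the one case left to Lander's parity theorem

Framing: lottery ticket; floor = certified bounds/negative ranges.

Cell pub-namedobj (venture DiscreteObjects), target (H), hadamard gen 6.  Of the 111 odd primes `p ≤ 661` excluded from the
prime-order spectrum of `Aut(2-(667,333,166))` by the census (FAMILY-F12-G5 §9), 110 are kernel theorems (p232555, p235022).  The
last one, `p = 29`, needs Lander's parity theorem (Symmetric Designs, 1983, Thm 3.20(2): `167` is self-conjugate mod `29`, so an
automorphism of order `29` fixes an odd number of points) — not formalised.  This file proves in the kernel exactly WHAT is left to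
that theorem: for a `0/1` incidence function with `|P| = |B| = 667`, row and column sums `333`, inner products `166` of distinct
rows and of distinct columns, an automorphism pair `(ρ, τ)` with `ρ^29 = τ^29 = 1`, `ρ ≠ 1` is FIXED-POINT-FREE on points and on
blocks, with exactly `23` orbits of length `29` on each side (`automorphism_29_fixedPointFree`): Cauchy–Schwarz (`cs29`, decide)
leaves only `m = 23` classes, and `#fixed + 29 m = 667` (`card_fixed_add_classes`).  In particular `(29; m = 22)` needs no
parity theorem.  Ours, not literature; no `sorry`.
-/

open Finset BigOperators

namespace Summit.Ventures.DiscreteObjects.Hadamard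

variable {P B : Type*} [Fintype P] [DecidableEq P] [Fintype B] [DecidableEq B]

set_option maxRecDepth 100000 in
/-- `p = 29`: every orbit number except `23` has negative discriminant -/
lemma cs29 : ∀ m ∈ Finset.range 24, 1 ≤ m → m ≠ 23 →
    (0 : ℤ) < 4 * (333 ^ 2 - (m : ℤ) * (167 + 166 * 29)) - (666 - (m : ℤ) * 29) ^ 2 := by decide

/-- one side: `23` classes of moved blocks and no fixed block -/
lemma side29 (N : P → B → ℤ) (h01 : ∀ x y, N x y = 0 ∨ N x y = 1)
    (hrow : ∀ x, ∑ y, N x y = 333) (hpair : ∀ x x', x ≠ x' → ∑ y, N x y * N x' y = 166)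
    (hB : Fintype.card B = 667)
    (ρ : Equiv.Perm P) (τ : Equiv.Perm B) (hN : ∀ x y, N (ρ x) (τ y) = N x y)
    (hρ : ρ ^ 29 = 1) (hτ : τ ^ 29 = 1) (x₀ : P) (hx₀ : ρ x₀ ≠ x₀) :
    (blockClasses τ 29).card = 23 ∧ (univ.filter fun y => τ y = y).card = 0 := by
  have hp : (29 : ℕ).Prime := by norm_num
  obtain ⟨hm1, σ, cs⟩ := orbitCount_cs N h01 hrow hpair 29 hp ρ τ hN hρ hτ x₀ hx₀
  have hcnt := card_fixed_add_classes τ hp hτ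
  rw [hB] at hcnt
  set m := (blockClasses τ 29).card with hmdef
  have hm : m = 23 := by
    by_contra hne
    exact cs_contra m 29 σ (by exact_mod_cast cs) (cs29 m (Finset.mem_range.mpr (by omega)) hm1 hne)
  exact ⟨hm, by omega⟩

/-- **Order 29 is fixed-point-free with 23 + 23 orbits.**  See the module docstring. -/
theorem automorphism_29_fixedPointFree (N : P → B → ℤ) (h01 : ∀ x y, N x y = 0 ∨ N x y = 1)
    (hrow : ∀ x, ∑ y, N x y = 333) (hpair : ∀ x x', x ≠ x' → ∑ y, N x y * N x' y = 166)
    (hcol : ∀ y, ∑ x, N x y = 333) (hcpair : ∀ y y', y ≠ y' → ∑ x, N x y * N x y' = 166)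
    (hP : Fintype.card P = 667) (hB : Fintype.card B = 667)
    (ρ : Equiv.Perm P) (τ : Equiv.Perm B) (hN : ∀ x y, N (ρ x) (τ y) = N x y)
    (hρ : ρ ^ 29 = 1) (hτ : τ ^ 29 = 1) (x₀ : P) (hx₀ : ρ x₀ ≠ x₀) :
    (blockClasses τ 29).card = 23 ∧ (univ.filter fun y => τ y = y).card = 0 ∧
    (blockClasses ρ 29).card = 23 ∧ (univ.filter fun x => ρ x = x).card = 0 := by
  obtain ⟨h1, h2⟩ := side29 N h01 hrow hpair hB ρ τ hN hρ hτ x₀ hx₀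
  -- dual structure
  obtain ⟨y₀, hy₀⟩ := exists_moved_block N h01 hrow hpair ρ τ hN hx₀
  obtain ⟨h3, h4⟩ := side29 (fun y x => N x y) (fun y x => h01 x y) hcol hcpair hP τ ρ (fun y x => hN x y)
    hτ hρ y₀ hy₀
  exact ⟨h1, h2, h3, h4⟩

end Summit.Ventures.DiscreteObjects.Hadamard
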